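import Literature.NumberTheory.Automorphic.RankinSelbergUnfoldingIdentity
import Literature.NumberTheory.Automorphic.RankinSelbergUnfoldingRealPointPairs
import Literature.NumberTheory.Automorphic.RankinSelbergUnfoldedEulerCuspidalPairs
import Literature.NumberTheory.Automorphic.RankinSelbergIntegralEntire
import Literature.NumberTheory.Automorphic.RankinSelbergIntegralNeConjResidue
import Literature.NumberTheory.Automorphic.PairLFunctionPolesEqConjLocalReduction
import HarnessLib

/-!
# The global Rankin–Selberg method for a PAIR of cusp forms: the unfolding identity on the strip
`1 < Re s < 2`, and an entire function equal to `s (s - 1) · C · L^{S'}(s, π × \bar{π'}) · Ψ_{S'}(s)`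
there, vanishing at `s = 1` for `π ≠ π'` — the global half of Mœglin–Waldspurger's Corollaire (i)(b)

Topic `NumberTheory/Automorphic`; namespace `Literature.NumberTheory.Automorphic`. Proof file (theorems
only: no definition, no named fact, no instance). For the named fact
`MoeglinWaldspurger1989_partialPairL_entire_of_ne_conj` (`PairLFunctionMeromorphicContinuation`;
Mœglin–Waldspurger (1989), Appendice, Corollaire (i)(b): `L^S(s, π × σ)` is entire for `π ≇ σ̃`) the
printed proof is the global Rankin–Selberg method for the pair (Jacquet–Shalika (1981), §4; Cogdell
(2004), §2.3, Thm. 2.1–2.2 and §4.2, proof of Thm. 4.2): the global integrals `I(s; φ, φ', Φ)` are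
meromorphic with at most simple poles at `s = 0, 1`, they unfold and factor as
`I(s) = C · L^{S'}(s, π × \bar{π'}) · Ψ_{S'}(s)`, and the residue at `s = 1`, `c Φ̂(0) ∫ φ φ'`, vanishes
unless `π' ≅ π̃`. This file proves exactly this GLOBAL half, in the honest `L²` model of the tree and for
every `n ≥ 1`.

§1 (`section Identity`). `exists_rankinSelbergIntegral_star_eq_mul_rankinSelbergTorusPairIntegralC` —
the pair version of `RankinSelbergUnfoldingIdentity` (Cogdell, Thm. 2.1: `I(s; φ, φ', Φ) =
Ψ(s; W_φ, W'_{φ'}, Φ)`) at COMPLEX points of the strip `1 < Re s < 2`: for cuspidal `π ∋ f`, `π' ∋ f'`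
transforming under the centre by the same unitary scalars, a test function `η` and a real
Schwartz–Bruhat `Φ ≥ 0`,
`rankinSelbergIntegral μ' ν_I Φ s (star (S_η f')) (S_η f) = C · rankinSelbergTorusPairIntegralC νA νK W_φ W̄_{φ'} Φ s`.
Proof: the real-point identity of `RankinSelbergUnfoldingRealPointPairs` (polarization) upgraded by the
identity theorem, both sides being holomorphic on the strip (`differentiableOn_rankinSelbergIntegral`;
`differentiableOn_setIntegral_mul_mul_torusWeightC` with the finiteness of the real torus integrals,
`RankinSelbergTorusFinitenessSchwartz`).

§2 (`section Global`). `exists_entire_eq_mul_rankinSelbergIntegral_star_of_ne` — for `π ≠ π'`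
(multiplicity one) the entire continuation `F` of `s (s - 1) I(s; S̄_η f', S_η f, Φ)`
(`exists_entire_eq_mul_rankinSelbergIntegral`, `RankinSelbergIntegralEntire`) vanishes at `s = 1`
(`tendsto_sub_one_mul_rankinSelbergIntegral_of_ne_conj`, `RankinSelbergIntegralNeConjResidue`); and
`exists_entire_eq_mul_partialPairL_mul_setIntegral_pair` (**main**) — there is `C > 0` (Haar measures)
such that for all cuspidal `π`, `π'` with Satake families `α`, `γ` off `S`, all `f ∈ π`, `f' ∈ π'` with
the same unitary central scalars, every test function `η` of level `K(𝔫₀)`, every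
`S' ⊇ S ∪ {v ∣ 𝔫₀} ∪ {v ∣ 𝔡_K}`, all enumerations `x`, `y` of `α`, `γ` off `S'` and every standard
Schwartz–Bruhat test function `Φ = Φ_∞ ⊗ 𝟙_{𝒪̂ⁿ}` (`Φ_∞ ≥ 0` continuous), there is an ENTIRE `F` with
`F(s) = s (s - 1) I(s; S̄_η f', S_η f, Φ)` for `re s > 1`,
`F(s) = s (s - 1) · C · partialPairL S' α γ̄ s · ∫_{B({v ∉ S'}) × K} I_s` for `1 < re s < 2` (§1 with the
Euler factorisation of `RankinSelbergUnfoldedEulerCuspidalPairs` for Tate's character, unramified off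
`𝔡_K` by `adicComponent_adeleAddChar_unramified`), and `F(1) = 0` whenever `π ≠ π'` (multiplicity one).
With `π' := σ̄` (`γ̄ =` the Satake family of `σ`) this is the input of
`MoeglinWaldspurger1989_partialPairL_entire_of_ne_conj_of_entire_mul` up to the remaining inputs of the
printed proof which the tree does not have: the LOCAL theory of the `S'`-part `Ψ_{S'}(s)` (continuation
and non-vanishing at every `s₀` for suitable data: Jacquet–Piatetski-Shapiro–Shalika (1983), §2;
Jacquet–Shalika (1981), §1, §3), the residue of `I(s)` at `s = 0` (the functional equation of the
mirabolic Eisenstein series; `RankinSelbergIntegralEntire`, "What is NOT here"), and the `η`-twisted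
Eisenstein series for the pairs with `ω_π ω_σ ≠ 1`.

## References

* C. Mœglin, J.-L. Waldspurger, *Le spectre résiduel de GL(n)*, Ann. Sci. ÉNS 22 (1989), Appendice,
  Corollaire (i)(b), p. 667 [MoeglinWaldspurger1989].
* J. W. Cogdell, *Analytic theory of L-functions for GL_n*, in *An Introduction to the Langlands
  Program* (2004), §2.3 Thm. 2.1–2.2, §4.2 proof of Thm. 4.2 [CogdellAnalyticTheory2004].
* H. Jacquet, J. A. Shalika, *On Euler products and the classification of automorphic
  representations I, II*, Amer. J. Math. 103 (1981), I §4 (4.4)–(4.6), II Prop. 3.6 [JacquetShalikaAJM1981].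
-/

noncomputable section

open MeasureTheory Measure NumberField IsDedekindDomain Matrix Set Filter Topology
open scoped ENNReal NNReal ComplexConjugate

namespace Literature.NumberTheory.Automorphic

open Literature.NumberTheory.GaloisRepresentations (ideleGroup)

-- the automorphic quotient carries the tree's Borel σ-algebra, not Mathlib's quotient σ-algebra
-- (verbatim from `RankinSelbergUnfoldingIdentity`)
attribute [-instance] Quotient.instMeasurableSpace QuotientGroup.measurableSpace

section PairGlobal

open ValuativeRel

variable {n : ℕ} {K : Type} [Field K] [NumberField K]
variable [MeasurableSpace (AdeleRing (𝓞 K) K)] [BorelSpace (AdeleRing (𝓞 K) K)]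

-- the house local instances, exactly as in `RankinSelbergUnfoldingIdentity`
attribute [local instance] adelicBorel borelSpace_adelic locallyCompactSpace_adelic secondCountableTopology_gl_adelic
  glAdeleBorel borelSpace_glAdele borelSpace_ideleGroup secondCountableTopology_ideleGroup

/-- **The unfolding identity for a pair on the strip `1 < Re s < 2`.** There is a constant `C > 0`,
depending only on the Haar measures, such that for all cuspidal automorphic representations `π`, `π'` of
`GL_n(𝔸_K)` (`0 < n`), all `f ∈ π`, `f' ∈ π'` transforming under the centre `Z(𝔸_K)` by the same scalars
of modulus one (`ω_π = ω_{π'}`), every test function `η`, every real Schwartz–Bruhat `Φ ≥ 0` with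
`g ↦ Φ(e_n g)` measurable and every `s` with `1 < Re s < 2`:
`I(s; S̄_η f', S_η f, Φ) = C · Ψ(s; W_φ, W̄_{φ'}, Φ)`, i.e.
`rankinSelbergIntegral μ' ν_I Φ s (star (S_η f')) (S_η f) = C · rankinSelbergTorusPairIntegralC νA νK W_φ (star W_{φ'}) Φ s`
(Cogdell (2004), Thm. 2.1; Jacquet–Shalika (1981), §4, (4.6)): both sides are holomorphic on the strip
and agree at its real points (`exists_rankinSelbergIntegral_star_eq_mul_rankinSelbergTorusPairIntegral`).
[cite: CogdellAnalyticTheory2004, §2.3 Thm. 2.1] [cite: JacquetShalikaAJM1981, §4] -/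
theorem exists_rankinSelbergIntegral_star_eq_mul_rankinSelbergTorusPairIntegralC (hn : 0 < n)
    (μ' : Measure (AdelicGroupData.gl n K).automorphicQuotient) [(AdelicGroupData.gl n K).IsAutomorphicMeasure μ']
    (νI : Measure (ideleGroup K)) [νI.IsHaarMeasure]
    (νA : Measure (Fin n → ideleGroup K)) [IsHaarMeasure νA]
    (νK : Measure ↥(maximalCompactAdelic n K)) [IsHaarMeasure νK]
    (ν₀ : Measure ↥(adelicUnipotent n K)) [IsHaarMeasure ν₀] :
    ∃ C : ℝ, 0 < C ∧
      ∀ (P Q : CuspidalAutomorphicRepGL n K μ') (f : P.1.toSubmodule) (f' : Q.1.toSubmodule),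
        (∀ z : ideleGroup K, ∃ c : ℂ, ‖c‖ = 1 ∧
          (AdelicGroupData.gl n K).rightRegular μ' (Matrix.GeneralLinearGroup.scalar (Fin n) z)
              (f : (AdelicGroupData.gl n K).L2 μ') = c • (f : (AdelicGroupData.gl n K).L2 μ') ∧
          (AdelicGroupData.gl n K).rightRegular μ' (Matrix.GeneralLinearGroup.scalar (Fin n) z)
              (f' : (AdelicGroupData.gl n K).L2 μ') = c • (f' : (AdelicGroupData.gl n K).L2 μ')) →
      ∀ {η : (AdelicGroupData.gl n K).Adelic → ℝ}, IsTestFunctionGL n K η →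
      ∀ {Φ : (Fin n → AdeleRing (𝓞 K) K) → ℝ}, (fun x => (Φ x : ℂ)) ∈ piSchwartzBruhat K (Fin n) →
        (∀ x, 0 ≤ Φ x) → (Measurable fun g : GL (Fin n) (AdeleRing (𝓞 K) K) => Φ (lastRow n K g)) →
      ∀ {s : ℂ}, 1 < s.re → s.re < 2 →
        rankinSelbergIntegral μ' νI (fun x => (Φ x : ℂ)) s
            (star (smoothedForm η (f' : (AdelicGroupData.gl n K).L2 μ')))
            (smoothedForm η (f : (AdelicGroupData.gl n K).L2 μ')) =
          (C : ℂ) * rankinSelbergTorusPairIntegralC n K νA νK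
            (whittakerCoeff ν₀ (unipotentTateDomain n K) (adeleAddChar K)
              (invQuot (AdelicGroupData.gl n K) (smoothedForm η (f : (AdelicGroupData.gl n K).L2 μ'))))
            (star (whittakerCoeff ν₀ (unipotentTateDomain n K) (adeleAddChar K)
              (invQuot (AdelicGroupData.gl n K) (smoothedForm η (f' : (AdelicGroupData.gl n K).L2 μ')))))
            Φ s := by
  classical
  haveI : T2Space (GL (Fin n) (AdeleRing (𝓞 K) K)) := t2Space_gl n K
  haveI : LocallyCompactSpace (GL (Fin n) (AdeleRing (𝓞 K) K)) :=
    AdelicGroupData.locallyCompactSpace_generalLinearGroup_adeleRing K (Fin n)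
  haveI : SecondCountableTopology (GL (Fin n) (AdeleRing (𝓞 K) K)) :=
    secondCountableTopology_generalLinearGroup_adeleRing K (Fin n)
  haveI : SecondCountableTopology (AdelicGroupData.gl n K).Adelic :=
    secondCountableTopology_generalLinearGroup_adeleRing K (Fin n)
  haveI : SecondCountableTopology ↥(maximalCompactAdelic n K) := TopologicalSpace.Subtype.secondCountableTopology _
  haveI hνIR : νI.IsMulRightInvariant := by
    haveI := isInvInvariant_of_isHaarMeasure_ideleGroup (K := K) νI
    infer_instance
  obtain ⟨C, hC0, hCt, hR⟩ :=
    exists_rankinSelbergIntegral_star_eq_mul_rankinSelbergTorusPairIntegral (n := n) (K := K) hn μ' νI νA νK ν₀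
  have hCpos : 0 < C.toReal := ENNReal.toReal_pos hC0 hCt
  refine ⟨C.toReal, hCpos, fun P Q f f' hZ {η} hη {Φ} hΦS hΦ0 hΦm {s} hs1 hs2 => ?_⟩
  -- the datum
  set φt : (AdelicGroupData.gl n K).automorphicQuotient → ℂ :=
    smoothedForm η (f : (AdelicGroupData.gl n K).L2 μ') with hφt
  set φt' : (AdelicGroupData.gl n K).automorphicQuotient → ℂ :=
    smoothedForm η (f' : (AdelicGroupData.gl n K).L2 μ') with hφt'
  set φ : GL (Fin n) (AdeleRing (𝓞 K) K) → ℂ := invQuot (AdelicGroupData.gl n K) φt with hφ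
  set φ' : GL (Fin n) (AdeleRing (𝓞 K) K) → ℂ := invQuot (AdelicGroupData.gl n K) φt' with hφ'
  have hφtc : Continuous φt := continuous_smoothedForm hη.continuous hη.hasCompactSupport _
  have hφt'c : Continuous φt' := continuous_smoothedForm hη.continuous hη.hasCompactSupport _
  have hφc : Continuous φ := continuous_invQuot_smoothedForm hη.continuous hη.hasCompactSupport _
  have hφ'c : Continuous φ' := continuous_invQuot_smoothedForm hη.continuous hη.hasCompactSupport _
  have hφd : IsRapidlyDecreasingGL n K φ := isRapidlyDecreasingGL_invQuot_smoothedForm hη (P.2.1 f.2)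
  have hφ'd : IsRapidlyDecreasingGL n K (invQuot (AdelicGroupData.gl n K) (star φt')) :=
    isRapidlyDecreasingGL_invQuot_star (isRapidlyDecreasingGL_invQuot_smoothedForm hη (Q.2.1 f'.2))
  set W : GL (Fin n) (AdeleRing (𝓞 K) K) → ℂ :=
    whittakerCoeff ν₀ (unipotentTateDomain n K) (adeleAddChar K) φ with hW
  set W' : GL (Fin n) (AdeleRing (𝓞 K) K) → ℂ :=
    whittakerCoeff ν₀ (unipotentTateDomain n K) (adeleAddChar K) φ' with hW'
  have hWc : Continuous W :=
    continuous_whittakerCoeff measurableSet_unipotentTateDomain isCompact_closure_unipotentTateDomain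
      (continuous_adeleAddChar (K := K)) hφc
  have hW'c : Continuous W' :=
    continuous_whittakerCoeff measurableSet_unipotentTateDomain isCompact_closure_unipotentTateDomain
      (continuous_adeleAddChar (K := K)) hφ'c
  have hW'sc : Continuous (star W') := hW'c.star
  -- the two holomorphic functions
  set U : Set ℂ := {z : ℂ | 1 < z.re ∧ z.re < 2} with hU
  have hUo : IsOpen U :=
    (isOpen_lt continuous_const Complex.continuous_re).inter (isOpen_lt Complex.continuous_re continuous_const)
  have hUc : IsPreconnected U := by
    have hUeq : U = Complex.reLm ⁻¹' Set.Ioo (1 : ℝ) 2 := by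
      ext z
      simp only [hU, Set.mem_setOf_eq, Set.mem_preimage, Set.mem_Ioo, Complex.reLm_coe]
    rw [hUeq]
    exact ((convex_Ioo (1 : ℝ) 2).linear_preimage Complex.reLm).isPreconnected
  have hI : DifferentiableOn ℂ (fun z => rankinSelbergIntegral μ' νI (fun x => (Φ x : ℂ)) z (star φt') φt) U :=
    differentiableOn_rankinSelbergIntegral (K := K) νI hn μ' hΦS (continuous_star.comp hφt'c) hφtc hφ'd hφd
  have hpt : Measurable (torusPoint n K) := continuous_torusPoint.measurable
  have hm : ∀ z : ℂ, AEStronglyMeasurable (fun p : (Fin n → ideleGroup K) × ↥(maximalCompactAdelic n K) =>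
      W (torusPoint n K p) * (star W') (torusPoint n K p) * (Φ (lastRow n K (torusPoint n K p)) : ℂ) *
        torusWeightC n K z p.1) (νA.prod νK) := fun z =>
    (measurable_torusPairIntegrandC (hWc.measurable.comp hpt) (hW'sc.measurable.comp hpt) (hΦm.comp hpt) z).aestronglyMeasurable
  have hmr : ∀ σ : ℝ, Measurable (torusIntegrand n K W Φ σ) := fun σ => measurable_torusIntegrand hWc hΦm σ
  have hmr' : ∀ σ : ℝ, Measurable (torusIntegrand n K (star W') Φ σ) := fun σ => measurable_torusIntegrand hW'sc hΦm σ
  have hfin : ∀ σ : ℝ, 1 < σ → rankinSelbergTorusIntegral n K νA νK W Φ σ ≠ ⊤ := fun σ hσ =>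
    rankinSelbergTorusIntegral_whittakerCoeff_ne_top_of_mem_piSchwartzBruhat hn νA νK ν₀ P f hη hΦS hΦ0 hΦm hσ
  have hfin₂ : ∀ σ : ℝ, 1 < σ → rankinSelbergTorusIntegral n K νA νK W' Φ σ ≠ ⊤ := fun σ hσ =>
    rankinSelbergTorusIntegral_whittakerCoeff_ne_top_of_mem_piSchwartzBruhat hn νA νK ν₀ Q f' hη hΦS hΦ0 hΦm hσ
  have hfin' : ∀ σ : ℝ, 1 < σ → rankinSelbergTorusIntegral n K νA νK (star W') Φ σ ≠ ⊤ := fun σ hσ => by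
    rw [rankinSelbergTorusIntegral_star]; exact hfin₂ σ hσ
  have hG : DifferentiableOn ℂ (fun z => (C.toReal : ℂ) * rankinSelbergTorusPairIntegralC n K νA νK W (star W') Φ z) U := by
    have h := differentiableOn_setIntegral_mul_mul_torusWeightC (σ₁ := 1) (σ₂ := 2) νA νK hΦ0 hm hmr hmr'
      (fun σ hσ₁ _ => hfin σ hσ₁) (fun σ hσ₁ _ => hfin' σ hσ₁) Set.univ
    simp_rw [Measure.restrict_univ] at h
    exact h.const_mul _
  -- equality at the real points of the strip
  have hreal : ∀ σ : ℝ, 1 < σ → σ < 2 →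
      rankinSelbergIntegral μ' νI (fun x => (Φ x : ℂ)) (σ : ℂ) (star φt') φt =
        (C.toReal : ℂ) * rankinSelbergTorusPairIntegralC n K νA νK W (star W') Φ (σ : ℂ) := by
    intro σ hσ1 _
    rw [hR (P.2.1 f.2) (Q.2.1 f'.2) hZ hη.continuous hη.hasCompactSupport hΦS hΦ0 hΦm hσ1 (hfin σ hσ1)
      (hfin₂ σ hσ1), rankinSelbergTorusPairIntegral_eq_rankinSelbergTorusPairIntegralC]
  -- the identity theorem
  have hEq := (hI.analyticOnNhd hUo).eqOn_of_preconnected_of_mem_closure (hG.analyticOnNhd hUo) hUc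
    (z₀ := ((3 / 2 : ℝ) : ℂ)) (by simp only [hU, Set.mem_setOf_eq, Complex.ofReal_re]; norm_num)
    (three_halves_mem_closure_real_strip fun σ hσ1 hσ2 => hreal σ hσ1 hσ2)
  exact hEq ⟨hs1, hs2⟩

/-! ### The global half of Corollaire (i)(b) -/

/-- **No pole at `s = 1` for `π ≠ π'`, in entire form.** For cuspidal `π ∋ f`, `π' ∋ f'` with `π ≠ π'`
(multiplicity one on `L²_cusp`), a test function `η`, `Φ ∈ piSchwartzBruhat` and a Haar measure `ν_I`:
there is an entire `F` with `F(s) = s (s - 1) I(s; S̄_η f', S_η f, Φ)` for `re s > 1`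
(`exists_entire_eq_mul_rankinSelbergIntegral`) and `F(1) = 0` — the residue `c Φ̂(0) ∫ S̄_η f' S_η f`
vanishes because `[S̄_η f'] ∈ \bar{π'}`, `[S_η f] ∈ π` and `\bar{π'} ≠ π̄`
(`tendsto_sub_one_mul_rankinSelbergIntegral_of_ne_conj`). Cogdell (2004), §4.2, proof of Thm. 4.2;
Jacquet–Shalika II, Prop. 3.6. [cite: CogdellAnalyticTheory2004, §4.2 (proof of Thm. 4.2)] -/
theorem exists_entire_eq_mul_rankinSelbergIntegral_star_of_ne (hn : 0 < n)
    (μ' : Measure (AdelicGroupData.gl n K).automorphicQuotient) [(AdelicGroupData.gl n K).IsAutomorphicMeasure μ']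
    (νI : Measure (ideleGroup K)) [νI.IsHaarMeasure]
    (P Q : CuspidalAutomorphicRepGL n K μ') (f : P.1.toSubmodule) (f' : Q.1.toSubmodule)
    {η : (AdelicGroupData.gl n K).Adelic → ℝ} (hη : IsTestFunctionGL n K η)
    {Φ : (Fin n → AdeleRing (𝓞 K) K) → ℂ} (hΦ : Φ ∈ piSchwartzBruhat K (Fin n)) :
    ∃ F : ℂ → ℂ, Differentiable ℂ F ∧
      (∀ s : ℂ, 1 < s.re → F s = s * (s - 1) * rankinSelbergIntegral μ' νI Φ s
        (star (smoothedForm η (f' : (AdelicGroupData.gl n K).L2 μ')))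
        (smoothedForm η (f : (AdelicGroupData.gl n K).L2 μ'))) ∧
      (multiplicity_one_gl n K μ' → P ≠ Q → F 1 = 0) := by
  classical
  haveI hνIR : νI.IsMulRightInvariant := by
    haveI := isInvInvariant_of_isHaarMeasure_ideleGroup (K := K) νI
    infer_instance
  -- the datum
  set φt : (AdelicGroupData.gl n K).automorphicQuotient → ℂ :=
    smoothedForm η (f : (AdelicGroupData.gl n K).L2 μ') with hφt
  set φt' : (AdelicGroupData.gl n K).automorphicQuotient → ℂ :=
    smoothedForm η (f' : (AdelicGroupData.gl n K).L2 μ') with hφt'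
  have hφtc : Continuous φt := continuous_smoothedForm hη.continuous hη.hasCompactSupport _
  have hφt'c : Continuous φt' := continuous_smoothedForm hη.continuous hη.hasCompactSupport _
  have hφd : IsRapidlyDecreasingGL n K (invQuot (AdelicGroupData.gl n K) φt) :=
    isRapidlyDecreasingGL_invQuot_smoothedForm hη (P.2.1 f.2)
  have hφ'd : IsRapidlyDecreasingGL n K (invQuot (AdelicGroupData.gl n K) (star φt')) :=
    isRapidlyDecreasingGL_invQuot_star (isRapidlyDecreasingGL_invQuot_smoothedForm hη (Q.2.1 f'.2))
  -- the entire continuation of `s (s - 1) I(s)`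
  obtain ⟨F, hF, hFI⟩ := exists_entire_eq_mul_rankinSelbergIntegral (K := K) νI hn μ' hΦ
    (show Continuous (star φt') from continuous_star.comp hφt'c) hφtc hφ'd hφd
  refine ⟨F, hF, hFI, fun h₁ hPQ => ?_⟩
  -- an additive Haar measure on `𝔸_Kⁿ` (for the residue formula)
  haveI : T2Space (AdeleRing (𝓞 K) K) := t2Space_adeleRing K
  haveI := secondCountableTopology_adeleRing K
  haveI := locallyCompactSpace_adeleRing' K
  set μA : Measure (Fin n → AdeleRing (𝓞 K) K) := Measure.addHaar with hμA
  -- the residue at `s = 1` vanishes: `[φ̄'] ∈ π̄'`, `[φ] ∈ π`, `π̄' ≠ π̄`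
  have hφm : φt ∈ cuspForms n K μ' := smoothedForm_mem_cuspForms P hη.continuous hη.hasCompactSupport f
  have hφ'm : φt' ∈ cuspForms n K μ' := smoothedForm_mem_cuspForms Q hη.continuous hη.hasCompactSupport f'
  have hP : cuspFormsToLp n K μ' ⟨φt, hφm⟩ ∈ P.1 :=
    cuspFormsToLp_smoothedForm_mem P hη.continuous hη.hasCompactSupport f
  have hQ' : cuspFormsToLp n K μ' ⟨star φt', star_mem_cuspForms μ' hφ'm⟩ ∈ Q.conj.1 :=
    cuspFormsToLp_star_mem_conj Q hφ'm (cuspFormsToLp_smoothedForm_mem Q hη.continuous hη.hasCompactSupport f')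
  have hne : Q.conj ≠ P.conj := fun h => hPQ (by
    have h' := congrArg CuspidalAutomorphicRepGL.conj h
    rwa [CuspidalAutomorphicRepGL.conj_conj, CuspidalAutomorphicRepGL.conj_conj, eq_comm] at h')
  have hres := tendsto_sub_one_mul_rankinSelbergIntegral_of_ne_conj νI hn μ' h₁ Q.conj P hne μA hΦ
    (star_mem_cuspForms μ' hφ'm) hφm hQ' hP hφ'd hφd
  -- `F(s) = s · ((s - 1) I(s)) → 1 · 0` and `F(s) → F(1)` along `s → 1`, `re s > 1`
  have hF1 : Tendsto F (𝓝[{s : ℂ | 1 < s.re}] 1) (𝓝 (F 1)) :=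
    (hF.continuous.tendsto 1).mono_left nhdsWithin_le_nhds
  have hF0 : Tendsto F (𝓝[{s : ℂ | 1 < s.re}] 1) (𝓝 0) := by
    have hid : Tendsto (fun s : ℂ => s) (𝓝[{s : ℂ | 1 < s.re}] 1) (𝓝 1) :=
      tendsto_id.mono_left nhdsWithin_le_nhds
    have h := hid.mul hres
    rw [one_mul] at h
    refine h.congr' ?_
    filter_upwards [self_mem_nhdsWithin] with s hs
    rw [hFI s hs]
    ring
  exact tendsto_nhds_unique hF1 hF0

/-- **The global half of Mœglin–Waldspurger's Corollaire (i)(b).** There is a constant `C > 0`,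
depending only on the Haar measures, such that for all cuspidal automorphic representations `π`, `π'`
of `GL_n(𝔸_K)` (`0 < n`) with Satake families `α`, `γ` off `S`, all `f ∈ π`, `f' ∈ π'` transforming
under the centre by the same scalars of modulus one, every ideal `𝔫₀ ≠ 0` and test function `η` left
invariant under `K(𝔫₀)`, every set of finite places `S' ⊇ S` off which `v ∤ 𝔫₀` and `v ∤ 𝔡_{K/ℚ}`,
all enumerations `x`, `y` of `α`, `γ` off `S'`, and every standard test function
`Φ = Φ_∞ ⊗ 𝟙_{𝒪̂ⁿ}` with `Φ_∞ ≥ 0` continuous and `Φ` Schwartz–Bruhat, there is an **entire** function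
`F` with

* `F(s) = s (s - 1) · I(s; S̄_η f', S_η f, Φ)` for `re s > 1` (`RankinSelbergIntegralEntire`);
* `F(s) = s (s - 1) · C · partialPairL S' α γ̄ s · ∫_{B({v ∉ S'}) × K} W_φ W̄_{φ'} Φ(e_n ·) |det|^s δ_B⁻¹`
  for `1 < re s < 2` — unfolding on the strip (`RankinSelbergUnfoldingIdentityPairs`) and the Euler
  factorisation of the pair (`RankinSelbergUnfoldedEulerCuspidalPairs`) for Tate's character, which
  has conductor `𝒪_v` off `𝔡` (`adicComponent_adeleAddChar_unramified`);
* `F(1) = 0` if `π ≠ π'` and `L²_cusp` has multiplicity one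
  (`exists_entire_eq_mul_rankinSelbergIntegral_star_of_ne`).

Cogdell (2004), Thm. 2.1–2.2 and §4.2 (proof of Thm. 4.2); Jacquet–Shalika (1981), §4; with `π' = σ̄`
this is the global Rankin–Selberg input of Mœglin–Waldspurger (1989), Appendice, Cor. (i)(b).
[cite: MoeglinWaldspurger1989, Appendice, Corollaire (i)(b)] [cite: CogdellAnalyticTheory2004, §2.3 Thm. 2.2, §4.2] -/
theorem exists_entire_eq_mul_partialPairL_mul_setIntegral_pair (hn : 0 < n)
    (μ' : Measure (AdelicGroupData.gl n K).automorphicQuotient) [(AdelicGroupData.gl n K).IsAutomorphicMeasure μ']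
    (νI : Measure (ideleGroup K)) [νI.IsHaarMeasure]
    (νA : Measure (Fin n → ideleGroup K)) [IsHaarMeasure νA]
    (νK : Measure ↥(maximalCompactAdelic n K)) [IsHaarMeasure νK]
    (ν₀ : Measure ↥(adelicUnipotent n K)) [IsHaarMeasure ν₀] :
    ∃ C : ℝ, 0 < C ∧
      ∀ (P Q : CuspidalAutomorphicRepGL n K μ') (f : P.1.toSubmodule) (f' : Q.1.toSubmodule),
        (∀ z : ideleGroup K, ∃ c : ℂ, ‖c‖ = 1 ∧
          (AdelicGroupData.gl n K).rightRegular μ' (Matrix.GeneralLinearGroup.scalar (Fin n) z)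
              (f : (AdelicGroupData.gl n K).L2 μ') = c • (f : (AdelicGroupData.gl n K).L2 μ') ∧
          (AdelicGroupData.gl n K).rightRegular μ' (Matrix.GeneralLinearGroup.scalar (Fin n) z)
              (f' : (AdelicGroupData.gl n K).L2 μ') = c • (f' : (AdelicGroupData.gl n K).L2 μ')) →
      ∀ {S : Set (HeightOneSpectrum (𝓞 K))} {α γ : SatakeFamily K}, IsSatakeFamilyOf P S α →
        IsSatakeFamilyOf Q S γ →
      ∀ {𝔫₀ : Ideal (𝓞 K)}, 𝔫₀ ≠ 0 →
      ∀ {η : (AdelicGroupData.gl n K).Adelic → ℝ}, IsTestFunctionGL n K η →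
        (∀ k : (AdelicGroupData.gl n K).Adelic, k ∈ principalCongruenceLevel n K 𝔫₀ →
          ∀ g : (AdelicGroupData.gl n K).Adelic, η (k * g) = η g) →
      ∀ {S' : Set (HeightOneSpectrum (𝓞 K))}, S ⊆ S' →
        (∀ v ∉ S', ¬ v.asIdeal ∣ 𝔫₀ ∧ ¬ v.asIdeal ∣ differentIdeal ℤ (𝓞 K)) →
      ∀ {x y : HeightOneSpectrum (𝓞 K) → Fin n → ℂ},
        (∀ v ∉ S', (Finset.univ : Finset (Fin n)).val.map (x v) = α v) →
        (∀ v ∉ S', (Finset.univ : Finset (Fin n)).val.map (y v) = γ v) →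
      ∀ {Φinf : (Fin n → InfiniteAdeleRing K) → ℝ}, Continuous Φinf → (∀ z, 0 ≤ Φinf z) →
        (fun v => ((standardTestFun n K Φinf v : ℝ) : ℂ)) ∈ piSchwartzBruhat K (Fin n) →
      ∃ F : ℂ → ℂ, Differentiable ℂ F ∧
        (∀ s : ℂ, 1 < s.re → F s = s * (s - 1) *
          rankinSelbergIntegral μ' νI (fun v => ((standardTestFun n K Φinf v : ℝ) : ℂ)) s
            (star (smoothedForm η (f' : (AdelicGroupData.gl n K).L2 μ')))
            (smoothedForm η (f : (AdelicGroupData.gl n K).L2 μ'))) ∧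
        (∀ s : ℂ, 1 < s.re → s.re < 2 → F s = s * (s - 1) * ((C : ℂ) *
          (partialPairL S' α (fun v => (γ v).map conj) s *
            ∫ p in unitBox {v | v ∉ S'} ×ˢ Set.univ, torusPairIntegrandC n K
              (whittakerCoeff ν₀ (unipotentTateDomain n K) (adeleAddChar K)
                (invQuot (AdelicGroupData.gl n K) (smoothedForm η (f : (AdelicGroupData.gl n K).L2 μ'))))
              (star (whittakerCoeff ν₀ (unipotentTateDomain n K) (adeleAddChar K)
                (invQuot (AdelicGroupData.gl n K) (smoothedForm η (f' : (AdelicGroupData.gl n K).L2 μ')))))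
              (standardTestFun n K Φinf) s p ∂(νA.prod νK)))) ∧
        (multiplicity_one_gl n K μ' → P ≠ Q → F 1 = 0) := by
  classical
  haveI : T2Space (GL (Fin n) (AdeleRing (𝓞 K) K)) := t2Space_gl n K
  haveI : LocallyCompactSpace (GL (Fin n) (AdeleRing (𝓞 K) K)) :=
    AdelicGroupData.locallyCompactSpace_generalLinearGroup_adeleRing K (Fin n)
  haveI : SecondCountableTopology (GL (Fin n) (AdeleRing (𝓞 K) K)) :=
    secondCountableTopology_generalLinearGroup_adeleRing K (Fin n)
  haveI hν₀R : ν₀.IsMulRightInvariant := isMulRightInvariant_of_isHaarMeasure_adelicUnipotent ν₀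
  -- `νA` is s-finite (σ-compact group) and `νK` is finite (compact group)
  haveI := locallyCompactSpace_ideleGroup K
  haveI : CompactSpace ↥(maximalCompactAdelic n K) :=
    isCompact_iff_compactSpace.1 (isCompact_maximalCompactAdelic n K)
  obtain ⟨C, hC, hunf⟩ :=
    exists_rankinSelbergIntegral_star_eq_mul_rankinSelbergTorusPairIntegralC (n := n) (K := K) hn μ' νI νA νK ν₀
  refine ⟨C, hC, fun P Q f f' hZ {S} {α} {γ} hα hγ {𝔫₀} h𝔫₀ {η} hη hηK {S'} hSS' hS' {x} {y} hx hy {Φinf} hΦic hΦi0 hΦS => ?_⟩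
  -- the test function
  set Φ : (Fin n → AdeleRing (𝓞 K) K) → ℝ := standardTestFun n K Φinf with hΦdef
  have hΦ0 : ∀ v, 0 ≤ Φ v := standardTestFun_nonneg hΦi0
  have hΦc : Continuous Φ := continuous_standardTestFun_of_continuous n K hΦic
  have hΦm : Measurable fun g : GL (Fin n) (AdeleRing (𝓞 K) K) => Φ (lastRow n K g) :=
    (hΦc.comp continuous_lastRow).measurable
  -- the entire continuation and the residue at `s = 1`
  obtain ⟨F, hF, hFI, hF1⟩ := exists_entire_eq_mul_rankinSelbergIntegral_star_of_ne hn μ' νI P Q f f' hη hΦS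
  refine ⟨F, hF, hFI, fun s hs1 hs2 => ?_, hF1⟩
  -- Tate's character and fundamental domain
  have hψ : IsGlobalAddChar K (adeleAddChar K) := isGlobalAddChar_adeleAddChar (K := K)
  have h𝓕 : IsFundamentalDomain ↥(rationalUnipotent n K) (unipotentTateDomain n K) ν₀ :=
    isFundamentalDomain_unipotentTateDomain ν₀
  have h𝓕c : IsCompact (closure (unipotentTateDomain n K)) := isCompact_closure_unipotentTateDomain
  have h𝓕m : MeasurableSet (unipotentTateDomain n K) := measurableSet_unipotentTateDomain
  have hGood : ∀ v ∉ S', ¬ v.asIdeal ∣ 𝔫₀ ∧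
      (∀ c ∈ 𝒪[v.adicCompletion K], (adeleAddChar K).adicComponent v c = 1) ∧
      ∀ ϖ : v.adicCompletion K, Valued.v ϖ = WithZero.exp (-1 : ℤ) →
        ∃ c ∈ 𝒪[v.adicCompletion K], (adeleAddChar K).adicComponent v (ϖ⁻¹ * c) ≠ 1 := fun v hv =>
    ⟨(hS' v hv).1, (adicComponent_adeleAddChar_unramified (K := K) (hS' v hv).2).1,
      (adicComponent_adeleAddChar_unramified (K := K) (hS' v hv).2).2⟩
  -- finiteness of the two real unfolded integrals at `re s`
  have hfin : rankinSelbergTorusIntegral n K νA νK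
      (whittakerCoeff ν₀ (unipotentTateDomain n K) (adeleAddChar K)
        (invQuot (AdelicGroupData.gl n K) (smoothedForm η (f : (AdelicGroupData.gl n K).L2 μ')))) Φ s.re ≠ ⊤ :=
    rankinSelbergTorusIntegral_whittakerCoeff_ne_top_of_mem_piSchwartzBruhat hn νA νK ν₀ P f hη hΦS hΦ0 hΦm hs1
  have hfin' : rankinSelbergTorusIntegral n K νA νK
      (whittakerCoeff ν₀ (unipotentTateDomain n K) (adeleAddChar K)
        (invQuot (AdelicGroupData.gl n K) (smoothedForm η (f' : (AdelicGroupData.gl n K).L2 μ')))) Φ s.re ≠ ⊤ :=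
    rankinSelbergTorusIntegral_whittakerCoeff_ne_top_of_mem_piSchwartzBruhat hn νA νK ν₀ Q f' hη hΦS hΦ0 hΦm hs1
  -- unfold on the strip and factor
  rw [hFI s hs1, hunf P Q f f' hZ hη hΦS hΦ0 hΦm hs1 hs2,
    rankinSelbergTorusPairIntegralC_whittakerCoeff_eq_partialPairL_mul hn P Q hα hγ h𝔫₀ hη.continuous
      hη.hasCompactSupport hηK f f' h𝓕 h𝓕m h𝓕c hψ hSS' hGood hx hy hΦi0 hΦm νA νK hs1 hfin hfin']

end PairGlobal

end Literature.NumberTheory.Automorphic
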